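import Mathlib.RingTheory.MvPolynomial.Homogeneous
import Mathlib.LinearAlgebra.Finsupp.LinearCombination
import Mathlib.LinearAlgebra.Basis.VectorSpace
import Mathlib.LinearAlgebra.Projection
import Mathlib.RingTheory.Ideal.Maps
import HarnessLib

/-!
# Ideals of a polynomial ring generated by linear forms are prime

For a field `K` and an arbitrary index type `ι`, an ideal of `MvPolynomial ι K` generated by
*linear forms* (elements homogeneous of degree `1`, i.e. `∑ c i • X i`, cf.
`MvPolynomial.homogeneousSubmodule_one_eq_span_X`) is prime, hence radical and proper.

This is the sentence Neusel–Smith use without comment inside the proof of Feshbach's theorem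
[cite: NeuselSmith2010, § 6.4, proof of Theorem 6.4.7, PDF p.177]: «the ideals `I_g` are prime
ideals as they are generated by linear forms», `I_g = ((1 - g)V*) ⊆ 𝔽[V]`; § 3 below states exactly
that case (`isPrime_span_range_X_sub`).

Tree precedents (searched `IsPrime`, `span_X_image`, `IsHomogeneous 1`): the coordinate case
`Literature.RingTheory.MvPolynomial.VariableIdeals.isPrime_span_X_image` (`(xᵢ : i ∈ s)` prime over
a domain) and the `Fin n`-indexed subspace form
`Literature.AlgebraicGeometry.Resolution.RidgePerfectField.isPrime_ideal_span_of_le_one` (proved by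
an adapted basis change inside the ridge/directrix library).  The present file is the general-`ι`,
set-of-generators form with a short coordinate-free proof and Mathlib-only imports, so that the
invariant-theory files (`Literature/RepresentationTheory/ClassicalInvariants`) need not import the
resolution-of-singularities cone; neither precedent is restated.

## Main statements

* `isPrime_span_image` — for a subspace `U ≤ (ι →₀ K)` of coefficient vectors, the ideal
  generated by the linear forms `∑ c i • X i`, `c ∈ U`, is prime (private helper
  `exists_algHom_ker_eq_span_image`: it is the kernel of a substitution endomorphism).
* `isPrime_span_of_isHomogeneous_one` — **the ideal generated by any set of linear forms is
  prime**; `radical_span_of_isHomogeneous_one`, `span_ne_top_of_isHomogeneous_one`,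
  `isPrime_span_coe_of_le_one` (subspace packaging).
* `isPrime_span_range_X_sub`, `radical_span_range_X_sub` — N–S p.177: for a family `v` of linear
  forms (think `v i = ρ g (X i)` for a linear representation `ρ`), `I = (X i - v i : i)` is prime and
  `√I = I`.

## Proof

[folklore] Choose a complement `W` of `U` (`Submodule.exists_isCompl`) and let `T` be the projection
onto `W` along `U`.  With `φ c = ∑ c i • X i` (`Finsupp.linearCombination K X`), the substitution
`P = aeval (fun j => φ (T e_j))` satisfies `P (φ c) = φ (T c)`; so `P` kills the generators `φ u`,
`u ∈ U`, and `f - P f ∈ I` for every `f` (induction on `f`, via `X j - P (X j) = φ (e_j - T e_j)`,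
`e_j - T e_j ∈ U`).  Hence `I = ker P`, a kernel of a ring map into a domain (`RingHom.ker_isPrime`).
-/

open _root_.MvPolynomial

namespace Literature.RingTheory.MvPolynomial.LinearFormIdeals

variable {K : Type*} [Field K] {ι : Type*}

/-! ## § 1. The ideal of a subspace of linear forms is a kernel -/

/-- For a subspace `U` of coefficient vectors there is a `K`-algebra endomorphism `P` of
`MvPolynomial ι K` whose kernel is exactly the ideal generated by the linear forms with
coefficients in `U`, and which is a retraction modulo that ideal (`f - P f ∈ I`). [folklore] -/
private theorem exists_algHom_ker_eq_span_image (U : Submodule K (ι →₀ K)) :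
    ∃ P : MvPolynomial ι K →ₐ[K] MvPolynomial ι K,
      RingHom.ker P =
          Ideal.span (Finsupp.linearCombination K (fun i : ι => (X i : MvPolynomial ι K)) '' U) ∧
        ∀ f, f - P f ∈
          Ideal.span (Finsupp.linearCombination K (fun i : ι => (X i : MvPolynomial ι K)) '' U) := by
  classical
  set φ := Finsupp.linearCombination K (fun i : ι => (X i : MvPolynomial ι K)) with hφ
  set I : Ideal (MvPolynomial ι K) := Ideal.span (φ '' U) with hI
  obtain ⟨W, hUW⟩ := U.exists_isCompl
  -- `T` = projection onto `W` along `U`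
  set T : (ι →₀ K) →ₗ[K] (ι →₀ K) := W.projection U hUW.symm with hT
  have hTU : ∀ u ∈ U, T u = 0 := fun u hu => Submodule.projection_apply_of_mem_right hUW.symm hu
  have hsub : ∀ x, x - T x ∈ U := fun x => Submodule.sub_projection_mem hUW.symm x
  set g : ι → MvPolynomial ι K := fun j => φ (T (Finsupp.single j 1)) with hg
  set P : MvPolynomial ι K →ₐ[K] MvPolynomial ι K := aeval g with hP
  -- `P ∘ φ = φ ∘ T` (both linear; check on the vectors `e_j = single j 1`)
  have hlin : P.toLinearMap ∘ₗ φ = φ ∘ₗ T := by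
    refine Finsupp.lhom_ext' fun j => LinearMap.ext_ring ?_
    simp only [LinearMap.coe_comp, Function.comp_apply, AlgHom.toLinearMap_apply,
      Finsupp.lsingle_apply, hφ, Finsupp.linearCombination_single, one_smul, hP, aeval_X]
    rfl
  have hPφ : ∀ c, P (φ c) = φ (T c) := fun c => by
    simpa only [LinearMap.coe_comp, Function.comp_apply, AlgHom.toLinearMap_apply] using
      LinearMap.congr_fun hlin c
  have hle : I ≤ RingHom.ker P := by
    rw [hI, Ideal.span_le]
    rintro _ ⟨u, hu, rfl⟩
    rw [SetLike.mem_coe, RingHom.mem_ker, hPφ u, hTU u hu, map_zero]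
  have hXj : ∀ j, (X j : MvPolynomial ι K) - g j ∈ I := by
    intro j
    have : (X j : MvPolynomial ι K) - g j = φ (Finsupp.single j 1 - T (Finsupp.single j 1)) := by
      rw [map_sub, hg, hφ, Finsupp.linearCombination_single, one_smul]
    rw [this]
    exact Ideal.subset_span ⟨_, hsub _, rfl⟩
  have hdiff : ∀ f : MvPolynomial ι K, f - P f ∈ I := by
    intro f
    induction f using MvPolynomial.induction_on with
    | C a =>
      rw [hP, aeval_C, MvPolynomial.algebraMap_eq, sub_self]
      exact I.zero_mem
    | add p q hp hq =>
      rw [map_add, add_sub_add_comm]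
      exact I.add_mem hp hq
    | mul_X p j hp =>
      have : p * X j - P (p * X j) = p * (X j - g j) + (p - P p) * g j := by
        rw [map_mul, hP, aeval_X]
        ring
      rw [this]
      exact I.add_mem (I.mul_mem_left _ (hXj j)) (I.mul_mem_right _ hp)
  have hge : RingHom.ker P ≤ I := fun f hf => by
    have h := hdiff f
    rwa [RingHom.mem_ker.mp hf, sub_zero] at h
  exact ⟨P, le_antisymm hge hle, hdiff⟩

/-- **An ideal generated by linear forms is prime** (subspace form): for a `K`-subspace `U` of
coefficient vectors, the ideal of `MvPolynomial ι K` generated by the linear forms `∑ c i • X i`,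
`c ∈ U`, is prime.
[cite: NeuselSmith2010, § 6.4, proof of Theorem 6.4.7, PDF p.177 («prime ideals as they are
generated by linear forms»)] -/
theorem isPrime_span_image (U : Submodule K (ι →₀ K)) :
    (Ideal.span
        (Finsupp.linearCombination K (fun i : ι => (X i : MvPolynomial ι K)) '' U)).IsPrime := by
  obtain ⟨P, hker, -⟩ := exists_algHom_ker_eq_span_image U
  rw [← hker]
  exact RingHom.ker_isPrime P

/-! ## § 2. Sets of linear forms -/

/-- The ideal generated by a set `L` of linear forms equals the ideal generated by the linear
forms with coefficient vector in the subspace `U = φ⁻¹(K ∙ L)`. [folklore] -/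
private theorem span_eq_span_image_comap {L : Set (MvPolynomial ι K)} (hL : ∀ ℓ ∈ L, ℓ.IsHomogeneous 1) :
    Ideal.span L =
      Ideal.span
        (Finsupp.linearCombination K (fun i : ι => (X i : MvPolynomial ι K)) ''
          (Submodule.span K L).comap
            (Finsupp.linearCombination K (fun i : ι => (X i : MvPolynomial ι K)))) := by
  set φ := Finsupp.linearCombination K (fun i : ι => (X i : MvPolynomial ι K)) with hφ
  have hrange : Submodule.span K L ≤ LinearMap.range φ := by
    rw [hφ, Finsupp.range_linearCombination, ← MvPolynomial.homogeneousSubmodule_one_eq_span_X]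
    exact Submodule.span_le.mpr fun ℓ hℓ => (mem_homogeneousSubmodule 1 ℓ).mpr (hL ℓ hℓ)
  have himage : φ '' ((Submodule.span K L).comap φ) = Submodule.span K L := by
    rw [← Submodule.map_coe, Submodule.map_comap_eq_self hrange]
  rw [himage]
  apply le_antisymm
  · exact Ideal.span_mono Submodule.subset_span
  · rw [Ideal.span_le]
    intro x hx
    exact Submodule.span_le_restrictScalars K (MvPolynomial ι K) L hx

/-- **An ideal generated by linear forms is prime** (set form, any index type): if every element
of `L ⊆ MvPolynomial ι K` is homogeneous of degree `1`, then `Ideal.span L` is a prime ideal.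
[cite: NeuselSmith2010, § 6.4, proof of Theorem 6.4.7, PDF p.177] -/
theorem isPrime_span_of_isHomogeneous_one {L : Set (MvPolynomial ι K)}
    (hL : ∀ ℓ ∈ L, ℓ.IsHomogeneous 1) : (Ideal.span L).IsPrime := by
  rw [span_eq_span_image_comap hL]
  exact isPrime_span_image _

/-- An ideal generated by linear forms is radical. [cite: NeuselSmith2010, § 6.4, proof of
Theorem 6.4.7, PDF p.177] -/
theorem radical_span_of_isHomogeneous_one {L : Set (MvPolynomial ι K)}
    (hL : ∀ ℓ ∈ L, ℓ.IsHomogeneous 1) : (Ideal.span L).radical = Ideal.span L :=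
  (isPrime_span_of_isHomogeneous_one hL).radical

/-- An ideal generated by linear forms is proper (part of «prime»). [cite: NeuselSmith2010, § 6.4,
proof of Theorem 6.4.7, PDF p.177] -/
theorem span_ne_top_of_isHomogeneous_one {L : Set (MvPolynomial ι K)}
    (hL : ∀ ℓ ∈ L, ℓ.IsHomogeneous 1) : Ideal.span L ≠ ⊤ :=
  (isPrime_span_of_isHomogeneous_one hL).ne_top

/-- Subspace packaging: for a `K`-subspace `T` of the degree-`1` component, `Ideal.span T` is
prime — the general-`ι` form of the tree's `Fin n` lemma
`Literature.AlgebraicGeometry.Resolution.RidgePerfectField.isPrime_ideal_span_of_le_one`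
(not imported here). [cite: NeuselSmith2010, § 6.4, proof of Theorem 6.4.7, PDF p.177] -/
theorem isPrime_span_coe_of_le_one {T : Submodule K (MvPolynomial ι K)}
    (hT : T ≤ homogeneousSubmodule ι K 1) :
    (Ideal.span (T : Set (MvPolynomial ι K))).IsPrime :=
  isPrime_span_of_isHomogeneous_one fun ℓ hℓ => (mem_homogeneousSubmodule 1 ℓ).mp (hT hℓ)

/-! ## § 3. The ideals `I_g = ((1 - g) V*)` of a linear action (N–S p.177) -/

/-- **N–S p.177: the ideals `I_g` are prime.**  For a family `v : ι → MvPolynomial ι K` of linear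
forms — e.g. `v i = ρ g (X i)` for a linear (= graded) action `ρ` on `𝔽[V]` — the ideal
`I = (X i - v i : i ∈ ι)` generated by the linear forms `(1 - g) xᵢ` is prime.
[cite: NeuselSmith2010, § 6.4, proof of Theorem 6.4.7, PDF p.177] -/
theorem isPrime_span_range_X_sub (v : ι → MvPolynomial ι K) (hv : ∀ i, (v i).IsHomogeneous 1) :
    (Ideal.span (Set.range fun i : ι => (X i : MvPolynomial ι K) - v i)).IsPrime := by
  refine isPrime_span_of_isHomogeneous_one ?_
  rintro _ ⟨i, rfl⟩
  exact (isHomogeneous_X K i).sub (hv i)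

/-- Hence `√I_g = I_g`. [cite: NeuselSmith2010, § 6.4, proof of Theorem 6.4.7, PDF p.177] -/
theorem radical_span_range_X_sub (v : ι → MvPolynomial ι K) (hv : ∀ i, (v i).IsHomogeneous 1) :
    (Ideal.span (Set.range fun i : ι => (X i : MvPolynomial ι K) - v i)).radical =
      Ideal.span (Set.range fun i : ι => (X i : MvPolynomial ι K) - v i) :=
  (isPrime_span_range_X_sub v hv).radical

/-- And `I_g` is a proper ideal (part of «prime»). [cite: NeuselSmith2010, § 6.4, proof of
Theorem 6.4.7, PDF p.177] -/
theorem span_range_X_sub_ne_top (v : ι → MvPolynomial ι K) (hv : ∀ i, (v i).IsHomogeneous 1) :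
    Ideal.span (Set.range fun i : ι => (X i : MvPolynomial ι K) - v i) ≠ ⊤ :=
  (isPrime_span_range_X_sub v hv).ne_top

end Literature.RingTheory.MvPolynomial.LinearFormIdeals
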